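import Summits.Ventures.HodgeRepro2.T5SplitPlaceUnitaryGroup
import Summits.Ventures.HodgeRepro2.T5FinitePlaceCM
import Summits.Ventures.HodgeRepro2.T5FinitePlaceSplitConj
import Summits.Ventures.HodgeRepro2.T5HermitianLocalIsotropyN3

/-!
# The record's `U(V)(F⁺_v)` at a NON-SPLIT place is seat p8's `U(H_w)` on `K_w` (cell pub-hodge-repro2, seat p3)

Tier-5 N3 support: seat p8's inert-place package (T5-CHECK-N3-p8.md §§22–39; the Hecke algebra, the Cartan cells,
the Satake chain of files 186–221) lives on «`E_w` with the star `σ`» (`starRingOfQuadratic h2 σ hσ`, `σ ∈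
Gal(K_w/K⁺_v)` non-trivial) for a hermitian matrix `H` over `E_w`; its «stays prose» cell (§26.1, §27.3, §28.4)
is «that the datum's `E_v/F_v` IS the pair `(L_w, K_v)` of Mathlib's completions at the datum's places». The
record's local group is the isometry group of `1 ⊗ H` over the local algebra `K⁺_v ⊗ K` with the conjugation
`1 ⊗ c` (file 225's `tensorGram` / `tensorStarRing`). At a NON-SPLIT place (`θ` not a `v`-adic square) file
127's `tensorLiftEquivOfNotIsSquare : K⁺_v ⊗ K ≃+* K_w` carries `1 ⊗ c` to the local complex conjugation
(file 122's `localComplexConj`, file 119's `localStarRing`):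
* `nonSplitEquiv_star` — the star compatibility (file 131's `tensorLiftEquiv_star` on the CM datum);
* `tensorGram_map_tensorLiftEquiv` — `1 ⊗ H` reads as `H_w := H.map (K → K_w)`;
* **`recordNonSplitEquiv : U(1 ⊗ H) ≃* U(H_w)`** for this seat's star (`localStarRing`, `star = c_w`);
* `formUnitaryGroup_congr` — the isometry group depends on the star only through its values, and
  **`recordNonSplitEquiv' : U(1 ⊗ H) ≃* U(H_w)`** for SEAT p8's star `starRingOfQuadratic h2 (localConj)
  (localConj_ne_one)` (file 180's bridge `star_starRingOfQuadratic_localConj`): the record's local group IS the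
  carrier of p8's package, on the route's own objects.
With file 225 (split places) every finite place of `F⁺` is covered: split ⇒ `GL_n(F⁺_v)`, non-split ⇒ p8's
`U(H_w)`. What is NOT here: the integral points on the tensor side (`K_v` as a subgroup of `U(1 ⊗ H)`).

Mathlib + this seat's files 122 / 127 / 129 / 131 / 180 / 225 and their imports; no display; no device.
§8(d): uses an L-value-free non-vanishing device: NO.
-/

namespace Summit.Ventures.HodgeRepro2.T5NonSplitPlaceUnitaryGroup

open Matrix NumberField NumberField.IsCMField IsDedekindDomain IsDedekindDomain.HeightOneSpectrum Module
open scoped TensorProduct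
open Summit.Ventures.HodgeRepro2.T5UnitaryGroupForm Summit.Ventures.HodgeRepro2.T5SplitPlaceUnitaryGroup
  Summit.Ventures.HodgeRepro2.T5FinitePlaceSplitClassification Summit.Ventures.HodgeRepro2.T5FinitePlaceSplitConj
  Summit.Ventures.HodgeRepro2.T5FinitePlaceTensorEquiv Summit.Ventures.HodgeRepro2.T5FinitePlaceCM
  Summit.Ventures.HodgeRepro2.T5StarOfInvolution Summit.Ventures.HodgeRepro2.T5FinitePlaceNormIndex
  Summit.Ventures.HodgeRepro2.T5HermitianLocalIsotropyN3

/-! ## The isometry group depends on the star only through its values -/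

section Congr

variable {E : Type*} [CommRing E] {ι : Type*} [Fintype ι] [DecidableEq ι]

omit [Fintype ι] [DecidableEq ι] in
/-- Two stars with the same values give the same conjugate transpose. -/
theorem conjTranspose_congr (i₁ i₂ : StarRing E)
    (h : ∀ y : E, (letI := i₁; star y) = (letI := i₂; star y)) (M : Matrix ι ι E) :
    (letI := i₁; Mᴴ) = (letI := i₂; Mᴴ) :=
  Matrix.ext fun i j => h (M j i)

/-- Two stars with the same values give the same isometry group. -/
theorem formUnitaryGroup_congr (i₁ i₂ : StarRing E)
    (h : ∀ y : E, (letI := i₁; star y) = (letI := i₂; star y)) (J : Matrix ι ι E) :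
    (letI := i₁; formUnitaryGroup J) = (letI := i₂; formUnitaryGroup J) := by
  ext g
  letI := i₁
  change (letI := i₁; (g : Matrix ι ι E)ᴴ * J * g = J) ↔ (letI := i₂; (g : Matrix ι ι E)ᴴ * J * g = J)
  rw [conjTranspose_congr i₁ i₂ h]

end Congr

/-! ## The record's local group at a non-split place -/

section Record

variable (K : Type*) [Field K] [NumberField K] [IsCMField K]
variable (v : HeightOneSpectrum (𝓞 (maximalRealSubfield K))) (w : HeightOneSpectrum (𝓞 K))
  [w.asIdeal.LiesOver v.asIdeal]
variable {θ : maximalRealSubfield K} {y : K}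
  (hθ : algebraMap (maximalRealSubfield K) K θ = y ^ 2) (hy : complexConj K y ≠ y)
  (hsq : ¬ IsSquare (algebraMap (maximalRealSubfield K) (v.adicCompletion (maximalRealSubfield K)) θ))
variable {n : Type*} [Fintype n] [DecidableEq n]

/-- `K⁺_v ⊗ K ≃+* K_w` at a non-split place (file 127's `tensorLiftEquivOfNotIsSquare` as a ring isomorphism). -/
noncomputable def nonSplitEquiv :
    ((v.adicCompletion (maximalRealSubfield K)) ⊗[maximalRealSubfield K] K) ≃+* w.adicCompletion K :=
  @AlgEquiv.toRingEquiv (v.adicCompletion (maximalRealSubfield K))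
    ((v.adicCompletion (maximalRealSubfield K)) ⊗[maximalRealSubfield K] K) (w.adicCompletion K) _ _ _ _
    (T5FinitePlaceLiesOver.instAlgebra (maximalRealSubfield K) K v w)
    (tensorLiftEquivOfNotIsSquare v w hθ.symm (span_pair_eq_top K hy) hsq)

/-- `nonSplitEquiv` is `tensorLiftEquivOfNotIsSquare`. -/
theorem nonSplitEquiv_apply (z : (v.adicCompletion (maximalRealSubfield K)) ⊗[maximalRealSubfield K] K) :
    nonSplitEquiv K v w hθ hy hsq z = tensorLiftEquivOfNotIsSquare v w hθ.symm (span_pair_eq_top K hy) hsq z :=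
  rfl

/-- **`nonSplitEquiv` carries `1 ⊗ c` to the local complex conjugation**: the star compatibility (file 131's
`tensorLiftEquiv_star` on the CM datum `(y, θ)`). -/
theorem nonSplitEquiv_star (z : (v.adicCompletion (maximalRealSubfield K)) ⊗[maximalRealSubfield K] K) :
    letI := tensorStarRing K v
    letI := localStarRing K hθ hy v w hsq
    nonSplitEquiv K v w hθ hy hsq (star z) = star (nonSplitEquiv K v w hθ hy hsq z) :=
  T5FinitePlaceTensorClassification.tensorLiftEquiv_star K v w hθ.symm (span_pair_eq_top K hy) hsq
    (complexConj_apply_eq_neg K hθ hy) z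

omit [Fintype n] [DecidableEq n] in
/-- `1 ⊗ H` reads, through `nonSplitEquiv`, as `H_w := H.map (K → K_w)`. -/
theorem tensorGram_map_nonSplitEquiv (H : Matrix n n K) :
    (tensorGram K v H).map (nonSplitEquiv K v w hθ hy hsq) = H.map (algebraMap K (w.adicCompletion K)) := by
  refine Matrix.ext fun i j => ?_
  rw [Matrix.map_apply, tensorGram_apply, Matrix.map_apply, nonSplitEquiv_apply,
    algebraMap_eq_tensorLiftEquiv_one_tmul v w (finrank_eq_of_not_isSquare v w hθ.symm (span_pair_eq_top K hy) hsq)]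
  rfl

/-- **THE RECORD'S `U(V)(F⁺_v)` AT A NON-SPLIT PLACE IS `U(H_w)`** — for this seat's star on `K_w`
(`localStarRing`, `star = c_w`): the isometry group of `1 ⊗ H` over `K⁺_v ⊗ K` is isomorphic to the isometry
group of `H_w` over `K_w` (file 225's `unitaryMapEquiv` along `nonSplitEquiv`). -/
noncomputable def recordNonSplitEquiv (H : Matrix n n K) :
    (letI := tensorStarRing K v; ↥(formUnitaryGroup (tensorGram K v H))) ≃*
      (letI := localStarRing K hθ hy v w hsq; ↥(formUnitaryGroup (H.map (algebraMap K (w.adicCompletion K))))) := by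
  letI := tensorStarRing K v
  letI := localStarRing K hθ hy v w hsq
  exact (unitaryMapEquiv (nonSplitEquiv K v w hθ hy hsq) (nonSplitEquiv_star K v w hθ hy hsq)
    (tensorGram K v H)).trans
    (MulEquiv.subgroupCongr (congrArg formUnitaryGroup (tensorGram_map_nonSplitEquiv K v w hθ hy hsq H)))

/-- `recordNonSplitEquiv` on the underlying matrices: `nonSplitEquiv` applied entrywise. -/
theorem coe_recordNonSplitEquiv (H : Matrix n n K)
    (g : (letI := tensorStarRing K v; ↥(formUnitaryGroup (tensorGram K v H)))) :
    (((recordNonSplitEquiv K v w hθ hy hsq H g).1 : GL n (w.adicCompletion K)) : Matrix n n (w.adicCompletion K)) =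
      (g.1 : Matrix n n ((v.adicCompletion (maximalRealSubfield K)) ⊗[maximalRealSubfield K] K)).map
        (nonSplitEquiv K v w hθ hy hsq) := rfl

include hθ hy hsq in
/-- The local degree is `2` at a non-split place, for seat p4's `K⁺_v`-algebra structure on `K_w` (file 141's
`finrank_eq_two'`). -/
theorem finrank_eq_two : finrank (v.adicCompletion (maximalRealSubfield K)) (w.adicCompletion K) = 2 :=
  finrank_eq_two' v w hθ.symm (span_pair_eq_top K hy) hsq

/-- Seat p8's star on `K_w` at the local conjugation (file 180's `σ = localConj`) has the same values as this
seat's `localStarRing` (file 180's `star_starRingOfQuadratic_localConj`). -/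
theorem star_p8_eq_star (z : w.adicCompletion K) :
    (letI := starRingOfQuadratic (finrank_eq_two K v w hθ hy hsq)
        (localConj v w hθ.symm (span_pair_eq_top K hy) hsq (complexConj K))
        (localConj_ne_one v w hθ.symm (span_pair_eq_top K hy) hsq (complexConj K)
          (complexConj_apply_eq_neg K hθ hy));
      star z) =
      (letI := localStarRing K hθ hy v w hsq; star z) :=
  star_starRingOfQuadratic_localConj v w hθ.symm (span_pair_eq_top K hy) hsq (complexConj K)
    (complexConj_apply_eq_neg K hθ hy) (finrank_eq_two K v w hθ hy hsq) z

/-- **THE RECORD'S `U(V)(F⁺_v)` AT A NON-SPLIT PLACE IS SEAT p8's `U(H_w)`** — with p8's star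
`starRingOfQuadratic h2 σ hσ` at `σ = localConj` (the carrier of T5-CHECK-N3 §§22–39 and of files 186–221):
`recordNonSplitEquiv` followed by `formUnitaryGroup_congr`. -/
noncomputable def recordNonSplitEquiv' (H : Matrix n n K) :
    (letI := tensorStarRing K v; ↥(formUnitaryGroup (tensorGram K v H))) ≃*
      (letI := starRingOfQuadratic (finrank_eq_two K v w hθ hy hsq)
          (localConj v w hθ.symm (span_pair_eq_top K hy) hsq (complexConj K))
          (localConj_ne_one v w hθ.symm (span_pair_eq_top K hy) hsq (complexConj K)
            (complexConj_apply_eq_neg K hθ hy));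
        ↥(formUnitaryGroup (H.map (algebraMap K (w.adicCompletion K))))) :=
  (recordNonSplitEquiv K v w hθ hy hsq H).trans
    (MulEquiv.subgroupCongr (formUnitaryGroup_congr _ _ (fun z => (star_p8_eq_star K v w hθ hy hsq z).symm) _))

end Record

end Summit.Ventures.HodgeRepro2.T5NonSplitPlaceUnitaryGroup
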